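import Summits.ValiantsHypothesis.ValiantsHypothesis.Theorems.PolyaContinuedSignedCoverLittleEven
import HarnessLib

/-!
# Route PolyaContinued — support item `SignedCoverLittle` (stmt-ValiantsHypothesis-7426):
# step (EVEN) as cell multiplicities — the six perfect matchings of a Case-B source

Sequel to `…SignedCoverLittleEven.lean` (odd evenly-covering families of directed circuits; arc
coverage of the Case-B digraph; `not_isPfaffianBipartite_of_caseB'`). The lead's line
`even_induction` (crux workfile `Cruxes/SignedCoverLittle/Lines/even_induction.lean`) phrases the
core as `stub_even`: *every cell of the source lies in an even number of its perfect matchings*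
(the parity endgame `not_isPfaffianBipartite_of_even_multiplicity` of `…Parity.lean` then
contradicts Pfaffian-ness). This file delivers that MULTIPLICITY form from the same Case-B data
(the (EAR) interface `ear_caseB`, forks in both supports):

* `countP_apply_eq_self_add`, `odd_countP_apply_eq_self` — under even arc coverage a vertex is
  fixed by an odd number of the members of an odd family;
* `even_countP_cons_one` — adjoining the identity (the diagonal reference matching) to an odd
  family with even arc coverage, EVERY cell, diagonal included, is covered an even number of times;
* `even_countP_caseB` — the six perfect matchings `1, γ₊, γ₋, Z 0, Z 1, Z 2` of a Case-B source
  cover every cell `0`, `2`, `4` or (diagonal) `6 − (vertex coverage)` times;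
* `card_filter_eq_countP`, `nodup_caseB`, `even_card_filter_caseB` — the same as the cardinality
  statement `Even #{σ | PM σ ∧ σ c.1 = c.2}` that `stub_even` asks for, given that the
  permutations satisfying `PM` are exactly the six (pairwise distinct by the (EAR) interface:
  `γ₊ ≠ γ₋`, `Z` injective, `Z j ≠ γ₊, γ₋`, circuits `≠ 1`).
-/

namespace Summit.ValiantsHypothesis.PolyaContinued

open Equiv Equiv.Perm Finset Literature.Combinatorics.SimpleGraph

/-! ### Cell multiplicities: the six perfect matchings of a Case-B source are evenly spread -/

section Multiplicity

variable {n : ℕ}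

/-- Fixed points versus moved points: `#{γ ∈ F | γ a = a} + #{γ ∈ F | γ a ≠ a} = |F|`.
[folklore] -/
theorem countP_apply_eq_self_add (F : List (Perm (Fin n))) (a : Fin n) :
    F.countP (fun γ => γ a = a) + F.countP (fun γ => γ a ≠ a) = F.length := by
  induction F with
  | nil => simp
  | cons γ F ih =>
    simp only [List.countP_cons, List.length_cons, decide_eq_true_eq]
    by_cases h : γ a = a
    · rw [if_pos h, if_neg (not_not.2 h)]
      omega
    · rw [if_neg h, if_pos h]
      omega

/-- Under even arc coverage, a vertex is FIXED by an odd number of the members of an odd family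
(it is moved by an even number of them, `even_countP_ne_self`). [folklore] -/
theorem odd_countP_apply_eq_self (F : List (Perm (Fin n)))
    (heven : ∀ a b : Fin n, a ≠ b → Even (F.countP fun γ => γ a = b)) (hodd : Odd F.length)
    (a : Fin n) : Odd (F.countP fun γ => γ a = a) := by
  have h := countP_apply_eq_self_add F a
  rw [← h] at hodd
  exact (Nat.odd_add.1 hodd).2 (even_countP_ne_self F heven a)

/-- **Even cell multiplicities.** Adjoin the identity (the reference perfect matching, i.e. the
diagonal) to an odd family `F` of permutations with even arc coverage: then EVERY cell `(a, b)`,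
diagonal or not, is a cell of an even number of members of `1 :: F` — off the diagonal these are
the arcs of `F` (even by hypothesis), on the diagonal the identity together with the odd number of
members of `F` fixing `a` (`odd_countP_apply_eq_self`). [folklore] -/
theorem even_countP_cons_one (F : List (Perm (Fin n)))
    (heven : ∀ a b : Fin n, a ≠ b → Even (F.countP fun γ => γ a = b)) (hodd : Odd F.length)
    (a b : Fin n) : Even (((1 : Perm (Fin n)) :: F).countP fun γ => γ a = b) := by
  by_cases hab : a = b
  · subst hab
    rw [List.countP_cons_of_pos (by simp)]
    exact (odd_countP_apply_eq_self F heven hodd a).add_one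
  · rw [List.countP_cons_of_neg (by simpa using hab)]
    exact heven a b hab

/-- **The six perfect matchings `1, γ₊, γ₋, Z 0, Z 1, Z 2` of a Case-B source cover every cell an
even number of times** (`0`, `2`, `4` or, on the diagonal, `6 − (vertex coverage)`); hypotheses in
the shape of the (EAR) interface, forks in both supports. [folklore] -/
theorem even_countP_caseB {μ ν : Perm (Fin n)} (hμ : μ.IsCycle) (hν : ν.IsCycle)
    {p : Fin 3 → Fin n} {Z : Fin 3 → Perm (Fin n)}
    (hpμ : ∀ j, p j ∈ μ.support) (hpν : ∀ j, p j ∈ ν.support)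
    (hZμ : ∀ j v, v ∈ pathSet μ (p j) (p (j + 1)) → Z j v = μ v)
    (hZν : ∀ j v, v ∈ pathSet ν (p (j + 1)) (p j) → Z j v = ν v)
    (hZfix : ∀ j v, v ∉ pathSet μ (p j) (p (j + 1)) → v ∉ pathSet ν (p (j + 1)) (p j) → Z j v = v)
    (hμpart : ∀ v ∈ μ.support, ∃! j, v ∈ pathSet μ (p j) (p (j + 1)))
    (hνpart : ∀ v ∈ ν.support, ∃! j, v ∈ pathSet ν (p (j + 1)) (p j)) (a b : Fin n) :
    Even ([(1 : Perm (Fin n)), μ, ν, Z 0, Z 1, Z 2].countP fun γ => γ a = b) := by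
  refine even_countP_cons_one [μ, ν, Z 0, Z 1, Z 2] (fun a b hab => ?_) ⟨2, rfl⟩ a b
  rw [countP_caseB μ ν p Z hZμ hZν hZfix (disjoint_pathSet_caseB hμ hν hpμ hpν hZμ hZν)
    hμpart hνpart hab]
  exact even_two_mul _

/-- From a duplicate-free LIST of the permutations satisfying `PM` to cardinalities: the number of
members satisfying `P` is the list count. [folklore] -/
theorem card_filter_eq_countP {L : List (Perm (Fin n))} (hL : L.Nodup) {PM : Perm (Fin n) → Prop}
    [DecidablePred PM] (hPM : ∀ σ, PM σ ↔ σ ∈ L) (P : Perm (Fin n) → Prop) [DecidablePred P] :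
    (Finset.univ.filter fun σ => PM σ ∧ P σ).card = L.countP fun σ => P σ := by
  have hset : (Finset.univ.filter fun σ => PM σ ∧ P σ) = (L.filter fun σ => P σ).toFinset := by
    ext σ
    simp only [Finset.mem_filter, Finset.mem_univ, true_and, List.mem_toFinset, List.mem_filter,
      decide_eq_true_eq, hPM]
  rw [hset, List.toFinset_card_of_nodup (hL.filter _), List.countP_eq_length_filter]

/-- The six perfect matchings of a Case-B source are pairwise distinct (the five circuits are not
the identity; `γ₊ ≠ γ₋`; the single-ear circuits are pairwise distinct and differ from `γ₊, γ₋`,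
as the (EAR) interface states). [folklore] -/
theorem nodup_caseB {μ ν : Perm (Fin n)} (hμ : μ.IsCycle) (hν : ν.IsCycle) (hμν : μ ≠ ν)
    {Z : Fin 3 → Perm (Fin n)} (hZc : ∀ j, (Z j).IsCycle) (hZinj : Function.Injective Z)
    (hZμ' : ∀ j, Z j ≠ μ) (hZν' : ∀ j, Z j ≠ ν) :
    [(1 : Perm (Fin n)), μ, ν, Z 0, Z 1, Z 2].Nodup := by
  have h01 : Z 0 ≠ Z 1 := fun h => absurd (hZinj h) (by decide)
  have h02 : Z 0 ≠ Z 2 := fun h => absurd (hZinj h) (by decide)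
  have h12 : Z 1 ≠ Z 2 := fun h => absurd (hZinj h) (by decide)
  simp only [List.nodup_cons, List.mem_cons, List.not_mem_nil, or_false, not_or, List.nodup_nil,
    and_true]
  exact ⟨⟨hμ.ne_one.symm, hν.ne_one.symm, (hZc 0).ne_one.symm, (hZc 1).ne_one.symm,
      (hZc 2).ne_one.symm⟩,
    ⟨hμν, (hZμ' 0).symm, (hZμ' 1).symm, (hZμ' 2).symm⟩,
    ⟨(hZν' 0).symm, (hZν' 1).symm, (hZν' 2).symm⟩, ⟨h01, h02⟩, h12, not_false⟩

/-- **(EVEN) as cell multiplicities — the form consumed by the line `even_induction`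
(`stub_even`).** If the perfect matchings of the source (the permutations satisfying `PM`) are
exactly the six of a Case-B configuration — the identity, the two lifted circuits `μ = γ₊`,
`ν = γ₋` and the three single-ear circuits `Z j` of the (EAR) interface — then every cell lies in
an even number of perfect matchings. [folklore] -/
theorem even_card_filter_caseB {PM : Perm (Fin n) → Prop} [DecidablePred PM]
    {μ ν : Perm (Fin n)} {p : Fin 3 → Fin n} {Z : Fin 3 → Perm (Fin n)}
    (hPM : ∀ σ, PM σ ↔ σ ∈ [(1 : Perm (Fin n)), μ, ν, Z 0, Z 1, Z 2])
    (hμ : μ.IsCycle) (hν : ν.IsCycle) (hμν : μ ≠ ν)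
    (hZc : ∀ j, (Z j).IsCycle) (hZinj : Function.Injective Z)
    (hZμ' : ∀ j, Z j ≠ μ) (hZν' : ∀ j, Z j ≠ ν)
    (hpμ : ∀ j, p j ∈ μ.support) (hpν : ∀ j, p j ∈ ν.support)
    (hZμ : ∀ j v, v ∈ pathSet μ (p j) (p (j + 1)) → Z j v = μ v)
    (hZν : ∀ j v, v ∈ pathSet ν (p (j + 1)) (p j) → Z j v = ν v)
    (hZfix : ∀ j v, v ∉ pathSet μ (p j) (p (j + 1)) → v ∉ pathSet ν (p (j + 1)) (p j) → Z j v = v)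
    (hμpart : ∀ v ∈ μ.support, ∃! j, v ∈ pathSet μ (p j) (p (j + 1)))
    (hνpart : ∀ v ∈ ν.support, ∃! j, v ∈ pathSet ν (p (j + 1)) (p j)) (c : Fin n × Fin n) :
    Even ((Finset.univ.filter fun σ => PM σ ∧ σ c.1 = c.2).card) := by
  rw [card_filter_eq_countP (nodup_caseB hμ hν hμν hZc hZinj hZμ' hZν') hPM (fun σ => σ c.1 = c.2)]
  exact even_countP_caseB hμ hν hpμ hpν hZμ hZν hZfix hμpart hνpart c.1 c.2

end Multiplicity

end Summit.ValiantsHypothesis.PolyaContinued
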